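import Summits.KontsevichZagierPeriods.Zeta5Search.DualSeriesSharpDenominators
import HarnessLib

/-!
# ζ(5) search — Brown–Zudilin's normalisation (35): the SHARP denominator of the constant term `V(b)` (cell `pub-zeta5`, TYPER)

HONEST FRAMING: systematic search; no irrationality claim unless certified.

`DualSeriesSharpDenominators.lean` (typer g6) proved `d^{5−o}·N♯(b)·c_{o,p} ∈ ℤ` for THE partial-fraction data of `R_b`
(`exists_int_data_sharp`, `N♯(b) = ∏_{pairs}(b₀−b_j−b_k)!/(b₂!b₃!) = sharpNormaliser b`, `d = lcm(1..b₀)`) and drew the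
consequences for the `ζ(5)`- and `ζ(3)`-coefficients (`coeffU_den_sharp`, `coeffW_den_sharp`).  This file adds the third
coefficient, by the argument of `DualSeriesDenominators.coeffV_den` verbatim with the sharp data:

* `coeffV_den_sharp` — **`d⁶ · N♯(b) · V(b) ∈ ℤ`** (`V(b) = coeffV b`, the canonical constant term; the truncated zeta sums
  `H_p^{(o+1)}` are cleared by `d^{o+1}`, `BallRivoal.isInt_dpow_mul_harm`).

It is the input of the record ray's denominator assembly (`Certificates/RecordRayDenominators*`): with it the product
`d⁹·N♯(b)N♯(b′)·(W(b′)V(b) − W(b)V(b′))` is an integer for every `b, b′ = b + e_j` in the box.  0 sorry.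
-/

noncomputable section

open Finset
open Literature.NumberTheory.Transcendental
open Literature.NumberTheory.Transcendental.BallRivoal

namespace Summit.KontsevichZagierPeriods.Zeta5Search

namespace DualSeriesDenominators

open DualSeries WedgeDictionary PFSteps

/-- **`d_{b₀}⁶ · N♯(b) · V(b) ∈ ℤ`** — the constant term with Brown–Zudilin's normaliser (35) (`V(b) = coeffV b`; the
truncated zeta sums `H_p^{(o+1)}` cleared by `d_{b₀}^{o+1}`). -/
theorem coeffV_den_sharp {b : ℕ → ℤ} (hb : InBox b)
    (hP : ∀ s, s < 6 → bn b (pfst s) + bn b (psnd s) ≤ bn b 0)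
    (hsum : ∑ j ∈ range 7, b (j + 1) ≤ 3 * b 0 + 1) :
    ∃ z : ℤ, ((Nat.lcmUpto (bn b 0) : ℕ) : ℚ) ^ 6 * sharpNormaliser b * coeffV b = z := by
  have hdiv : ∀ k : ℕ, 1 ≤ k → k ≤ bn b 0 → (k : ℤ) ∣ ((Nat.lcmUpto (bn b 0) : ℕ) : ℤ) :=
    fun k h1 h2 => natCast_dvd_lcmUpto h1 h2
  obtain ⟨c, hc, hint⟩ := exists_int_data_sharp hb hP hsum
  have hterm : ∀ o ∈ range 6, ∀ p ∈ range (bn b 0 + 1), ∃ z : ℤ,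
      ((Nat.lcmUpto (bn b 0) : ℕ) : ℚ) ^ 6 * sharpNormaliser b * (c o p * harm (o + 1) p) = z := by
    intro o ho p hp
    have ho' := mem_range.1 ho
    have hp' := Nat.lt_succ_iff.1 (mem_range.1 hp)
    obtain ⟨z, hz⟩ := hint o p ho' hp'
    obtain ⟨w, hw⟩ := isInt_dpow_mul_harm (bn b 0) (Nat.lcmUpto (bn b 0)) hdiv (o + 1) p hp'
    refine ⟨z * w, ?_⟩
    have e : (6 : ℕ) = (5 - o) + (o + 1) := by omega
    rw [e, pow_add]
    push_cast
    rw [← hz, ← hw]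
    ring
  choose z hz using hterm
  refine ⟨∑ o ∈ (range 6).attach, ∑ p ∈ (range (bn b 0 + 1)).attach, z o.1 o.2 p.1 p.2, ?_⟩
  have hV : coeffV b = ∑ o ∈ range 6, ∑ p ∈ range (bn b 0 + 1), c o p * harm (o + 1) p := by
    rw [coeffV, show (b 0).toNat = bn b 0 by rfl]
    refine sum_congr rfl fun o ho => sum_congr rfl fun p hp => ?_
    rw [(isPFData_pfData hc).eq hc (mem_range.1 ho) (Nat.lt_succ_iff.1 (mem_range.1 hp))]
  rw [hV, mul_sum, ← sum_attach]
  push_cast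
  refine sum_congr rfl fun o _ => ?_
  rw [mul_sum, ← sum_attach]
  exact sum_congr rfl fun p _ => hz o.1 o.2 p.1 p.2

end DualSeriesDenominators

end Summit.KontsevichZagierPeriods.Zeta5Search
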